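import Summits.CriticalPhenomena.PercolationContinuityZ3.Theorems.PercNearOneGluingNoHeavyLowerTailSunflowerChainCombSorted
import HarnessLib
import HarnessLib.Audit

/-!
# `NoHeavyLowerTail` (crux stmt-CriticalPhenomena-4575), abstract sunflower cubic: COMB_chain at ALL heights follows from COMB_chain at height two —
# the class fibre sum of a sorted class equals a class fibre sum of the quotient PULLED BACK along the class

Support file (seat `prim-ineq-gen-2` gen 20; `--supports stmt-CriticalPhenomena-4575`; sequel of `…SunflowerChainCombSorted`, p271032).  No `sorry`, no named facts.
Memo: run/shared/lean/prim/prim-ineq-gen-2/THREEBLOCK-GEN20.md §1(b), §4(i).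

SETTING (`…SunflowerCompositionChain`, `…SunflowerChainCombSorted`).  `G` is a quotient of heights `r` on blocks `B` (a sunflower on the threshold set `Σ b, Fin (r b)`),
`ZFC κ G c` the fibre sum of the kernel `κ` over the level-triple families of blockwise sorted class `c` (`= Σ_{L ∈ Π_b rearr (c b)} KC κ G L`, `ChainComb.ZFC_eq_sum_piFinset`).

THE REDUCTION.  A sorted level triple `u : Fin 3 → Fin (n+1)` factors as `u = embE u ∘ rankPat u` with `rankPat u : Fin 3 → Fin 3` its RANK PATTERN (one of `(0,0,0), (0,0,1),
(0,1,1), (0,1,2)`; `rankPat u = rankOf u ∘ u`) and `embE u : Fin 3 → Fin (n+1)` monotone (`embE_comp_rankPat`).  Reading a subset `S` of the height-two threshold set `Σ b, Fin 2`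
through the block statistics `S ↦ embE (c b) #(S ∩ block b)` is a chain gadget of heights `r` on the blocks `Fin 2` (`embGadget`), and the chain composition `G ∘ embGadget c` is a
quotient of HEIGHT TWO on the same blocks whose kernel values are those of `G` along `embE` (`KC_composeC_embGadget`).  Blockwise, `t ↦ embE (c b) ∘ t` is a bijection
`rearr (rankPat (c b)) → rearr (c b)` with inverse `s ↦ rankOf (c b) ∘ s`; hence

* **`ZFC_eq_ZFC_pullback`**: `ZFC κ G c = ZFC κ (G.composeC (embGadget c hc)) (fun b => rankPat (c b))` for every blockwise sorted `c`;
* **`comb_chain_of_height_two`**: if every height-two quotient on the blocks `B` is COMB_chain-positive for `κ`, then so is every quotient of every height on `B`;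
* **`Zp_composeC_nonneg_of_height_two`** / **`ZH_composeC_nonneg_of_height_two`**: under the same hypothesis, `0 ≤ Zκ(G ∘ h)` (resp. `0 ≤ ZH (G ∘ h)`) for EVERY quotient `G`
  of every height on `B` and every family of chain gadgets `h` — i.e. the partition lemma (row `κ`) for every sunflower reading the blocks `B` through arbitrary monotone chain
  statistics.
For THREE blocks the hypothesis — all monotone `[3]³ → M₃` are COMB_chain-positive for `s6H`, `s6G`, `s6T` — has been verified by exhaustive computation outside Lean
(595 433 quotients × 1000 classes, memo §1; the cyclic-star quotient is replayed in the kernel in `…SunflowerCyclicStarPartition`); its kernel replay (an enumerator of the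
monotone maps with a completeness proof + a compiled check) is the remaining step to the unconditional three-block theorem (memo §4).
-/

namespace Summit.CriticalPhenomena.PercolationContinuityZ3.Theorems.SunflowerPartition

open Finset

namespace ChainComb

/-! ## Rank patterns of sorted triples -/

variable {n : ℕ}

/-- The rank of a value among the (at most three) values of a triple `u`: `[u 0 < v] + [u 0 < u 1 ∧ u 1 < v]`. [this work] -/
def rankOf (u : Fin 3 → Fin (n + 1)) (v : Fin (n + 1)) : Fin 3 :=
  if u 0 < v then (if u 0 < u 1 ∧ u 1 < v then 2 else 1) else 0

/-- The rank pattern of a triple: `rankOf u ∘ u` (for a sorted `u`: `(0,0,0)`, `(0,0,1)`, `(0,1,1)` or `(0,1,2)`). [this work] -/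
def rankPat (u : Fin 3 → Fin (n + 1)) : Fin 3 → Fin 3 := rankOf u ∘ u

/-- The level embedding of a triple: rank `0 ↦ u 0`, rank `1 ↦` the second distinct value, rank `2 ↦ u 2`. [this work] -/
def embE (u : Fin 3 → Fin (n + 1)) : Fin 3 → Fin (n + 1) :=
  ![u 0, if u 0 < u 1 then u 1 else u 2, u 2]

/-- `rankOf u` is monotone. [this work] -/
theorem rankOf_mono (u : Fin 3 → Fin (n + 1)) : Monotone (rankOf u) := by
  intro v w hvw
  unfold rankOf
  by_cases h0v : u 0 < v
  · have h0w : u 0 < w := lt_of_lt_of_le h0v hvw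
    rw [if_pos h0v, if_pos h0w]
    by_cases h1 : u 0 < u 1 ∧ u 1 < v
    · rw [if_pos h1, if_pos ⟨h1.1, lt_of_lt_of_le h1.2 hvw⟩]
    · rw [if_neg h1]
      split_ifs <;> decide
  · rw [if_neg h0v]
    split_ifs <;> decide

/-- The rank pattern of a sorted triple is sorted. [this work] -/
theorem rankPat_mono {u : Fin 3 → Fin (n + 1)} (hu : Monotone u) : Monotone (rankPat u) :=
  (rankOf_mono u).comp hu

/-- The level embedding of a sorted triple is monotone. [this work] -/
theorem embE_mono {u : Fin 3 → Fin (n + 1)} (hu : Monotone u) : Monotone (embE u) := by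
  have h01 : u 0 ≤ u 1 := hu (by decide)
  have h12 : u 1 ≤ u 2 := hu (by decide)
  have m01 : embE u 0 ≤ embE u 1 := by
    show u 0 ≤ (if u 0 < u 1 then u 1 else u 2)
    split_ifs
    · exact h01
    · exact le_trans h01 h12
  have m12 : embE u 1 ≤ embE u 2 := by
    show (if u 0 < u 1 then u 1 else u 2) ≤ u 2
    split_ifs
    · exact h12
    · exact le_rfl
  intro i j hij
  fin_cases i <;> fin_cases j
  · exact le_rfl
  · exact m01
  · exact le_trans m01 m12
  · exact absurd hij (by decide)
  · exact le_rfl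
  · exact m12
  · exact absurd hij (by decide)
  · exact absurd hij (by decide)
  · exact le_rfl

/-- `embE u ∘ rankPat u = u` for a sorted triple. [this work] -/
theorem embE_comp_rankPat {u : Fin 3 → Fin (n + 1)} (hu : Monotone u) : embE u ∘ rankPat u = u := by
  have h01 : u 0 ≤ u 1 := hu (by decide)
  have h12 : u 1 ≤ u 2 := hu (by decide)
  funext k
  simp only [Function.comp_apply, rankPat, rankOf]
  fin_cases k
  · simp [embE]
  · show embE u (if u 0 < u 1 then (if u 0 < u 1 ∧ u 1 < u 1 then 2 else 1) else 0) = u 1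
    by_cases h : u 0 < u 1
    · rw [if_pos h, if_neg (fun hh => lt_irrefl _ hh.2)]
      simp [embE, h]
    · rw [if_neg h]
      simp only [embE, Matrix.cons_val_zero]
      exact le_antisymm h01 (not_lt.1 h)
  · show embE u (if u 0 < u 2 then (if u 0 < u 1 ∧ u 1 < u 2 then 2 else 1) else 0) = u 2
    by_cases h : u 0 < u 2
    · rw [if_pos h]
      by_cases h' : u 0 < u 1 ∧ u 1 < u 2
      · rw [if_pos h']
        simp [embE]
      · rw [if_neg h']
        simp only [embE, Matrix.cons_val_one, Matrix.cons_val_zero]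
        by_cases h1 : u 0 < u 1
        · rw [if_pos h1]
          have : ¬ u 1 < u 2 := fun hh => h' ⟨h1, hh⟩
          exact le_antisymm h12 (not_lt.1 this)
        · rw [if_neg h1]
    · rw [if_neg h]
      simp only [embE, Matrix.cons_val_zero]
      exact le_antisymm (le_trans h01 h12) (not_lt.1 h)

/-- Blockwise bijection, forward direction: `t ∈ rearr (rankPat u) ⟹ embE u ∘ t ∈ rearr u`. [this work] -/
theorem embE_comp_mem_rearr {u : Fin 3 → Fin (n + 1)} (hu : Monotone u) {t : Fin 3 → Fin 3} (ht : t ∈ rearr (rankPat u)) :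
    embE u ∘ t ∈ rearr u := by
  rw [rearr, mem_filter] at ht ⊢
  obtain ⟨_, i, hi⟩ := ht
  refine ⟨mem_univ _, i, ?_⟩
  rw [hi, ← Function.comp_assoc, embE_comp_rankPat hu]

/-- Blockwise bijection, backward direction: `s ∈ rearr u ⟹ rankOf u ∘ s ∈ rearr (rankPat u)`. [this work] -/
theorem rankOf_comp_mem_rearr (u : Fin 3 → Fin (n + 1)) {s : Fin 3 → Fin (n + 1)} (hs : s ∈ rearr u) :
    rankOf u ∘ s ∈ rearr (rankPat u) := by
  rw [rearr, mem_filter] at hs ⊢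
  obtain ⟨_, i, hi⟩ := hs
  refine ⟨mem_univ _, i, ?_⟩
  rw [hi]
  rfl

/-- Left inverse on `rearr (rankPat u)`. [this work] -/
theorem rankOf_comp_embE_comp {u : Fin 3 → Fin (n + 1)} (hu : Monotone u) {t : Fin 3 → Fin 3} (ht : t ∈ rearr (rankPat u)) :
    rankOf u ∘ (embE u ∘ t) = t := by
  rw [rearr, mem_filter] at ht
  obtain ⟨_, i, hi⟩ := ht
  rw [hi]
  show (rankOf u ∘ (embE u ∘ rankOf u ∘ u)) ∘ ⇑(perm3 i) = (rankOf u ∘ u) ∘ ⇑(perm3 i)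
  have : embE u ∘ rankOf u ∘ u = u := embE_comp_rankPat hu
  rw [this]

/-- Right inverse on `rearr u`. [this work] -/
theorem embE_comp_rankOf_comp {u : Fin 3 → Fin (n + 1)} (hu : Monotone u) {s : Fin 3 → Fin (n + 1)} (hs : s ∈ rearr u) :
    embE u ∘ (rankOf u ∘ s) = s := by
  rw [rearr, mem_filter] at hs
  obtain ⟨_, i, hi⟩ := hs
  rw [hi]
  show (embE u ∘ rankOf u ∘ u) ∘ ⇑(perm3 i) = u ∘ ⇑(perm3 i)
  rw [show embE u ∘ rankOf u ∘ u = u from embE_comp_rankPat hu]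

/-! ## The pulled-back quotient as a chain composition on the blocks `Fin 2` -/

variable {B : Type*} [Fintype B] [DecidableEq B] {r : B → ℕ}

/-- A subset of `Fin 2` has at most two elements (as a bound for `Fin 3`). [folklore] -/
theorem card_lt_three (S : Finset (Fin 2)) : S.card < 3 :=
  lt_of_le_of_lt (card_le_univ S) (by simp)

/-- The chain gadget on the blocks `Fin 2` reading block `b` through `embE (c b) #(S ∩ block b)`. [this work] -/
def embGadget (c : ∀ b : B, Fin 3 → Fin (r b + 1)) (hc : ∀ b, Monotone (c b)) : CGadget (fun _ : B => Fin 2) r where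
  lv b S := embE (c b) ⟨S.card, card_lt_three S⟩
  mono := by
    intro b S T hST
    exact embE_mono (hc b) (show (⟨S.card, card_lt_three S⟩ : Fin 3) ≤ ⟨T.card, card_lt_three T⟩ from card_le_card hST)

/-- Heights two on the blocks `B`. [this work] -/
abbrev two (B : Type*) : B → ℕ := fun _ => 2

/-- The staircases of the height-two threshold set have the prescribed number of thresholds in each block. [this work] -/
theorem card_slice_st (L : ∀ b : B, Fin 3 → Fin (two B b + 1)) (k : Fin 3) (b : B) :
    (⟨(slice (st L k) b).card, card_lt_three _⟩ : Fin 3) = L b k := by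
  have h1 : slice (st L k) b = univ.filter fun t : Fin 2 => t.val < (L b k).val := by
    ext t
    simp [st, mem_slice]
  have key : ∀ v : Fin 3, (⟨#(univ.filter fun t : Fin 2 => t.val < v.val), card_lt_three _⟩ : Fin 3) = v := by decide
  rw [Fin.ext_iff]
  simp only [h1]
  exact Fin.ext_iff.1 (key (L b k))

/-- The hit set of a height-two staircase family under `embGadget c` is the staircase family of the embedded levels. [this work] -/
theorem embGadget_hits_st (c : ∀ b : B, Fin 3 → Fin (r b + 1)) (hc : ∀ b, Monotone (c b))
    (L : ∀ b : B, Fin 3 → Fin (two B b + 1)) (k : Fin 3) :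
    (embGadget c hc).hits (st L k) = st (fun b => embE (c b) ∘ L b) k := by
  ext x
  rw [CGadget.mem_hits]
  simp only [st, mem_filter, mem_univ, true_and, Function.comp_apply]
  have h := card_slice_st L k x.1
  show x.2.val < (embE (c x.1) ⟨(slice (st L k) x.1).card, card_lt_three _⟩).val ↔ x.2.val < (embE (c x.1) (L x.1 k)).val
  rw [h]

/-- **Kernel values of the pulled-back quotient** are those of `G` along the embedding. [this work] -/
theorem KC_composeC_embGadget (κ : Fin 5 → Fin 5 → Fin 5 → ℤ) (G : Sunflower (Σ b, Fin (r b)))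
    (c : ∀ b : B, Fin 3 → Fin (r b + 1)) (hc : ∀ b, Monotone (c b)) (L : ∀ b : B, Fin 3 → Fin (two B b + 1)) :
    KC κ (G.composeC (embGadget c hc)) L = KC κ G (fun b => embE (c b) ∘ L b) := by
  unfold KC
  rw [Sunflower.composeC_lab, Sunflower.composeC_lab, Sunflower.composeC_lab,
    embGadget_hits_st c hc L 0, embGadget_hits_st c hc L 1, embGadget_hits_st c hc L 2]

/-! ## The reduction -/

/-- **PULL-BACK IDENTITY**: the class fibre sum of a blockwise sorted class `c` of `G` equals the class fibre sum of the rank-pattern class of the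
height-two quotient `G ∘ embGadget c`. [this work] -/
theorem ZFC_eq_ZFC_pullback (κ : Fin 5 → Fin 5 → Fin 5 → ℤ) (G : Sunflower (Σ b, Fin (r b)))
    (c : ∀ b : B, Fin 3 → Fin (r b + 1)) (hc : ∀ b, Monotone (c b)) :
    ZFC κ G c = ZFC κ (G.composeC (embGadget c hc)) (fun b => rankPat (c b)) := by
  rw [ZFC_eq_sum_piFinset κ G c hc,
    ZFC_eq_sum_piFinset κ (G.composeC (embGadget c hc)) (fun b => rankPat (c b)) (fun b => rankPat_mono (hc b))]
  symm
  refine sum_nbij' (fun L b => embE (c b) ∘ L b) (fun L b => rankOf (c b) ∘ L b) ?_ ?_ ?_ ?_ ?_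
  · intro L hL
    rw [Fintype.mem_piFinset] at hL ⊢
    exact fun b => embE_comp_mem_rearr (hc b) (hL b)
  · intro L hL
    rw [Fintype.mem_piFinset] at hL ⊢
    exact fun b => rankOf_comp_mem_rearr (c b) (hL b)
  · intro L hL
    rw [Fintype.mem_piFinset] at hL
    funext b
    exact rankOf_comp_embE_comp (hc b) (hL b)
  · intro L hL
    rw [Fintype.mem_piFinset] at hL
    funext b
    exact embE_comp_rankOf_comp (hc b) (hL b)
  · intro L _
    exact KC_composeC_embGadget κ G c hc L

/-- **COMB_chain at all heights from COMB_chain at height two** (same blocks, same kernel). [this work] -/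
theorem comb_chain_of_height_two (κ : Fin 5 → Fin 5 → Fin 5 → ℤ)
    (H2 : ∀ (G' : Sunflower (Σ b : B, Fin (two B b))) (c' : ∀ b : B, Fin 3 → Fin (two B b + 1)), 0 ≤ ZFC κ G' c')
    (G : Sunflower (Σ b, Fin (r b))) : ∀ c : (∀ b : B, Fin 3 → Fin (r b + 1)), 0 ≤ ZFC κ G c := by
  intro c
  by_cases hc : ∀ b, Monotone (c b)
  · rw [ZFC_eq_ZFC_pullback κ G c hc]
    exact H2 _ _
  · obtain ⟨b, hb⟩ := not_forall.1 hc
    rw [ZFC_eq_zero_of_not_monotone κ G c hb]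

variable {β : B → Type*} [∀ b, Fintype (β b)] [∀ b, DecidableEq (β b)]

/-- **Every chain composition of every height is `κ`-nonnegative once the height-two quotients on the same blocks are COMB_chain-positive.** [this work] -/
theorem Zp_composeC_nonneg_of_height_two (κ : Fin 5 → Fin 5 → Fin 5 → ℤ)
    (H2 : ∀ (G' : Sunflower (Σ b : B, Fin (two B b))) (c' : ∀ b : B, Fin 3 → Fin (two B b + 1)), 0 ≤ ZFC κ G' c')
    (G : Sunflower (Σ b, Fin (r b))) (h : CGadget β r) : 0 ≤ (G.composeC h).Zp κ :=
  G.Zp_composeC_nonneg_of_comb h κ (comb_chain_of_height_two κ H2 G)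

/-- Row H: **the partition lemma ★ for every sunflower reading the blocks `B` through arbitrary monotone chain statistics**, from COMB_chain of the height-two
quotients on `B` (for `B = Fin 3` verified by exhaustive computation, memo THREEBLOCK-GEN20 §1). [this work] -/
theorem ZH_composeC_nonneg_of_height_two
    (H2 : ∀ (G' : Sunflower (Σ b : B, Fin (two B b))) (c' : ∀ b : B, Fin 3 → Fin (two B b + 1)), 0 ≤ ZFC s6H G' c')
    (G : Sunflower (Σ b, Fin (r b))) (h : CGadget β r) : 0 ≤ (G.composeC h).ZH := by
  rw [Sunflower.ZH_eq_Zp]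
  exact Zp_composeC_nonneg_of_height_two s6H H2 G h

end ChainComb

end Summit.CriticalPhenomena.PercolationContinuityZ3.Theorems.SunflowerPartition
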